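import Summits.QuantumFields.BalabanUV.T4Continuum.Spine.NE1p.DressedSmallFieldOuterCount
import Summits.QuantumFields.BalabanUV.T4Continuum.Spine.NE1p.DressedSmallFieldInnerLabelsWitness

/-!
# T⁴ programme, spine estimate NE1′ (node O3b/H2) — WITNESS «THE THIRD AND FOURTH RESUMMATION STEPS FIRE — THE CUBE OUTSIDE Z′₀ IS
# PAID BY THE LARGE-FIELD LETTER»: the owner's N0v END `attachedPart_locE_le_of_coresAt_pencil_outerLabels`
# (`Spine/NE1p/DressedSmallFieldOuterCount`) APPLIED ONCE BY NAME — a DECIDED applier — on a toy whose term index IS the set of admissible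
# outer labels `⟨W′, ⟨F, p⟩⟩` of the footprint, with TWO decided inner configurations per member

Cell `pub-balaban`, sub-cell `t4`, row NE1′ formalisation crew (`t4/formal/NE1p/LEAVES.md` row W52 ∕ DAG N29zzw; INTENT HOME/CLAIMS.log l.20025,
BOOKED typer R-T127 l.20102; X170 its read), unit `b2b-balaban-t4-ne1p-formalise-leaf-09` (gen 12); PART 1 of 2 (D1).  ADDITIVE — imports the owner's N0v
`Spine/NE1p/DressedSmallFieldOuterCount` (t4-ne1p-p1 g29; → N0u `DressedSmallFieldInnerCount` → N0t → N0s → N0r; b13's `B13FamilySum` ∕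
`B13` in the cone) and the crew's W50.1 `Spine/NE1p/DressedSmallFieldInnerLabelsWitness` (leaf-06 g11; → S40.1 `DressedSmallFieldInnerLink`
(leaf-07 g16) + W45 `DressedSmallFieldFamiliesWitness` (leaf-10 g10) → W41 → W35 → W33 → W24, row NE5's `Support/B13HistWitness`) ONLY;
toy DATA `def`s + theorems; 0 `def … : Prop`, 0 cite, 0 sorry, 0 `attribute`; nothing of N0v ∕ N0u ∕ S40.1 ∕ W50 ∕ W45 ∕ W41 ∕ W35 ∕
W33 ∕ W24 ∕ b13 ∕ pv22 is restated — `attachedPart_locE_le_of_coresAt_pencil_outerLabels`, `link_torus'`, `RI`, `RI_pos`,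
`coveringFamilies_emptyFootprint`, `powerset_unitCube`, `δF`, `κF`, `α₆F`, `hκ_F`, `h229_F`, `hsmall_F`, `coveringFamilies_unitCube`,
`ctr0`, `hroom0`, `coreW`, `N₁_coreW`, `cM`, `letterMass_coreW`, `budget_half`, `dj_X₀`, `X₀`, `X₀_val`, `hrate_torus`, `torus_consts`,
`K₀_four` are used BY NAME.

WHY.  N0v supplies the THIRD and FOURTH of print's four resummation steps ([Balaban1988RGII] pp. 19–20: «For each Z′_i we sum over
all possible components of Z₀ determining this Z′_i. The we sum over all families of domains Z′_i such, that ∪Z′_i = Z′₀. … A sum over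
n components is estimated by a product of n sums» (2.35)–(2.37); «The last sum to estimate is the sum over Z′₀, or over Z∖Z′₀»
(2.39), KIND) in kernel, table-blind: its END indexes the cores of a polymer `Z` by OUTER LABELS `⟨W′, ⟨F, p⟩⟩` — the cubes `W′` of
`Z∖Z′₀`, a family `F` of scale-`(k+1)` domains covering the rest (print's `Z′_i`), a dependent choice `p Z′ ∈ J Z′` of inner datum
per member — and discharges the count by `fibredCount_le` ∘ `familyPi_count_le` (`Finset.prod_sum`: the sum over the choices `p` IS
the product of the members' inner sums; the subset sum over `W′` by (2.34)∕(2.39) KIND) under the per-member budget `hmember`, the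
(2.27)∘(2.37) link `hlink` and the rate bookkeeping `Rkp ≤ R − c₁·(v·e^{Rc′})`.  Every landed witness indexes its cores by `Unit`,
`Bool`, covering families (W45) or inner labels (W50): the dependent-choice fibre `F.pi J` and the large-field fibre `v^{#W′}` have NO
decided inhabitant, and N0v's END (TREE `Spine/NE1p/DressedSmallFieldOuterCount.lean` l.171, p233273) has 0 appliers at its landing — S40.2
re-sockets it with the link discharged (binders displayed), the owner's N0w COMPOSES `hmember`, S41∕S44 consume N0w.  Here, on pv22's
torus `tgeometry 4 N` — ONE geometry (the END lives at scale `k+1`; NO `foot`∕`hmono`):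
* §1 OUR NUMERALS: the count rate is W50's `RI := 2κ₀ + 3` BY NAME (one unit above the step rate `Rkp := 2κ₀ + 2` of W24's
  `hrate_torus`); the LARGE-FIELD LETTER `vO := e^{−5·RI}∕64` per uncovered cube (print's `e^{−(κ₁−1)}` per cube of `Z∖Z′₀`, (2.35)
  KIND — TYPE only) ⇒ `c₁·(vO·e^{RI·5}) = 1` (`c₁v_eq_one`) and N0v's `hRR` holds WITH EQUALITY (`hRR_O_eq`) at `c′ = 5`;
* §2 THE INNER DATUM: TWO decided configurations per member (`κ := fun _ => Bool`, `J Z′ := univ`), each carrying HALF the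
  (2.36)-KIND member budget: `nO Z′ b := ½·(α₆F·e^{−δFκF·d(Z′)}·e^{−RI(d(Z′)+5)})` — N0v's `hmember` MET WITH EQUALITY as a two-summand
  sum (`hmember_O_eq`), so `familyPi_count_le`'s `Finset.prod_sum` runs over `2^{#F}` choices;
* §3 IN KERNEL, LOCATED: the index of record `termsO Z` := ALL admissible outer labels (N0v's `hadm` with EQUALITY — the admissible set
  of `fibredCount_le` ∘ `familyPi_count_le` itself); **`sum_termsO_X₀`** — at the unit cube a sum over `termsO X₀` is the sum over the
  TWO covered labels `⟨∅, ⟨{X₀}, p⟩⟩` (`p X₀ = true ∕ false`; W45's `coveringFamilies_unitCube`) plus the ONE uncovered label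
  `⟨{0}, ⟨∅, Pi.empty⟩⟩` (W50's `coveringFamilies_emptyFootprint`, `Finset.pi_empty`); **`card_termsO_X₀ = 3`** (`Finset.card_pi`);
  **`sum_majO_X₀`** — the majorant mass at `X₀` in CLOSED FORM `α₆F·e^{−5RI} + vO`: the covered fibre carries the member budget IN
  FULL across its two configurations (`Finset.prod_sum` read backwards), the uncovered fibre the large-field letter;
* §4 THE LABEL-INDEXED CORES (toy DATA): one W33 core `coreW (cO l) r` per outer label, `cO l := (cM r∕2)·majO l`,
  `majO l := vO^{#W′}·Π_{x∈F.attach} nO x (p x)` — N0v's majorant SHAPE BY CHOICE, so `hAmp_O` holds by W41's `budget_half`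
  (`A₀ := 0`, `A₁ := A∕4`, `ϱ := 2`); the activity of record `actO` sums the cores' terms over `termsO Z` along the pencil
  `s ↦ 0 + s • liveTable` (`hact`∕`hscale` by `rfl`);
* §5 **`outerEnd_fires`** — N0v's END ONCE BY NAME (`D := tsys 4 N`, `G := tgeometry 4 N`, W33's `ctr0`∕`hroom0`, NE5's toy letters
  `(1, 0, 1)` INLINE, `J := fun _ => univ`, `n := nO`, `a := α₆F`, `r := δF·κF`, `R := RI`, `c′ := 5`, `v := vO`, W45's
  `hκ_F`∕`h229_F`∕`hsmall_F`, `hmember_O`, `hlink := link_torus' 4 N` — S40.1's theorem BY NAME, never restated —, `hRR_O`, `hadm_O`,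
  `hAmp_O`); conclusion LITERAL; closed form `≤ K₀(64,8)`;
* PART 2 `Spine/NE1p/DressedSmallFieldOuterLabelsWitnessLive` ((D1), imports THIS file only) — GENUINE: `actO_closedForm` (every
  polymer: ONE common W33 integral times the total weight), `actO_live`, **`outerEnd_live`** (the END's bounded quantity is NOT zero,
  W24's `exp_locE_cube`).

WORDING OF RECORD (crew row W52 = DAG N29zzw, typer R-T127 (ii): the holder's title of l.20025 + the typer's riders ADOPTED verbatim): «a
decided applier»; «`hmember` MET BY A CHOSEN inner weight, NOT by N0u's inner count ∘ (2.36) ∘ (1.28) (N0w∕S41)»; «(B3-amp) MET because the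
weights are CHOSEN as N0v's majorant — UNPRINTED for Bałaban's cores (G-ne9p2-5)»; «(B1b) NOT claimed»; S40.1's `link_torus'` BY NAME only —
S40.2's two-scale face `…_outerLabels_torus` is NOT applied here (a decided applier of it is a separate follower row).

HONEST FRAMING.  A DECIDED TOY ([folklore]; 0 sorry; 0 citations; no `def … : Prop` — the `def`s are toy DATA and one numeral; `OLabel`
is a type abbreviation).  The cores are THEOREM-backed instances of the cell's typed FORMAT of (2.14) (`B13TermParamGaussianBi.BiCore`)
over row NE5's TOY frame — NOT Bałaban's (2.14) terms, NOT rows NE2∕NE3's Gaussian data, NOT the substrate's `slotsOfRecord`; the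
inner datum `Bool` («two decided configurations determine the member, half the budget each») and «terms = all admissible outer labels»
are OUR toy choices — (B1b) is NOT claimed for Bałaban's densities; N0v's per-member budget `hmember` is MET BY A CHOSEN inner weight `nO`,
NOT by N0u's inner count ∘ (2.36) ∘ (1.28) (the owner's N0w ∕ the crew's S41 — NOT touched here); (B3)'s amplitude clause is MET because
the weights are CHOSEN as N0v's majorant — (B3-amp) stays UNPRINTED for Bałaban's cores (GAPS G-ne9p2-5);
(B3-count)'s third∕fourth steps are N0v §1∕§2's kernel counts, the link S40.1's kernel (2.27)-lemma on pv22's CONSTRUCTED torus;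
`e^{−5RI}∕64`, `½`, `A∕4` are OUR numerals over pv22's located letters `κ₀ = 64 log 162`, `K₀(64,8)`, `c₁ = 64`, `ν = 9`; print's
`e^{−(κ₁−1)}`∕«½Lκ»∕`5` and the shape `v^{#W′}·Π a·e^{−rd}·e^{−R(d+5)}` are N0v's DISPLAYED (2.35)–(2.39) print-shape, TYPE only —
no numeral of [Balaban1988RGII] is asserted as a fact about Bałaban's densities; 0 binders instantiated on Bałaban's densities; no
wall item; wall v1.7 (T4-DAG v46) does NOT move; R-t4r2-Q2 NOT met thereby; NE1′ ⇐ the named binders — NOT proved, NOT printed; spine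
PROVED 0∕9; count 9 unchanged.  Rung (B)+1 on ONE finite four-torus — NOT infinite volume, NOT a mass gap, NOT OS on ℝ⁴, NOT Clay.
HONEST DEPENDENCY: continuum YM on T⁴ ⇐ BetaPertH ∧ nine spine estimates (0/9 proved); BetaPertH ⇐ (D1) ∧ (D4) ∧ CAP+tail; G-an2-4
gates asym, D1 and NE2/3/4.
-/

noncomputable section

namespace Summit.QuantumFields.BalabanUV.T4Continuum.NE1p.DressedSmallFieldOuterLabelsWitness

open Set Metric MeasureTheory Complex
open scoped BigOperators
open Literature.MathematicalPhysics.QuantumFieldTheory.Balaban1983to89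
open Literature.MathematicalPhysics.QuantumFieldTheory.Balaban1983to89.B12TreeDecay (K₀ K₀_pos)
open Literature.MathematicalPhysics.QuantumFieldTheory.Balaban1983to89.B13Resummation (locE Geometry)
open Literature.MathematicalPhysics.QuantumFieldTheory.Balaban1983to89.B13FamilySum (coveringFamilies mem_coveringFamilies)
open Literature.MathematicalPhysics.QuantumFieldTheory.Balaban1983to89.TreeLengthTorus (TPt TDom tsys torusTreeLen)
open Literature.MathematicalPhysics.QuantumFieldTheory.Balaban1983to89.TreeLengthTorusGeometry (tgeometry TTouch)
open Summit.QuantumFields.BalabanUV.T4Continuum.B13HistMeasurable (B13HistM)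
open Summit.QuantumFields.BalabanUV.T4Continuum.B13HistWitness (toyFrame)
open Summit.QuantumFields.BalabanUV.T4Continuum.B13TermParamGaussianBi (BiCore)
open Summit.QuantumFields.BalabanUV.T4Continuum.NE1p.DressedSmallFieldTorusWitness (X₀ X₀_val hrate_torus)
open Summit.QuantumFields.BalabanUV.T4Continuum.NE1p.DressedSmallFieldGeometry (torus_consts)
open Summit.QuantumFields.BalabanUV.T4Continuum.NE1p.DressedSmallFieldGeometryFaces (K₀_four)
open Summit.QuantumFields.BalabanUV.T4Continuum.NE1p.DressedSmallFieldCoresWitness (E1 liveTable norm_liveTable_le coreW N₁_coreW ctr0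
  hroom0 Acst Acst_pos)
open Summit.QuantumFields.BalabanUV.T4Continuum.NE1p.DressedSmallFieldCoresMassWitness (letterMass_coreW cM cM_pos)
open Summit.QuantumFields.BalabanUV.T4Continuum.NE1p.DressedSmallFieldDepCoresWitness (budget_half dj_X₀)
open Summit.QuantumFields.BalabanUV.T4Continuum.NE1p.DressedSmallFieldFamiliesWitness (δF κF α₆F α₆F_pos α₆F_le_one hκ_F h229_F hsmall_F
  coveringFamilies_unitCube)
open Summit.QuantumFields.BalabanUV.T4Continuum.NE1p.DressedSmallFieldInnerLink (link_torus')
open Summit.QuantumFields.BalabanUV.T4Continuum.NE1p.DressedSmallFieldInnerLabelsWitness (RI RI_pos coveringFamilies_emptyFootprint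
  powerset_unitCube)
open Summit.QuantumFields.BalabanUV.T4Continuum.NE1p.DressedSmallFieldOuterCount (attachedPart_locE_le_of_coresAt_pencil_outerLabels)

section Torus
variable (N : ℕ) [NeZero N]

/-! ## §1 OUR NUMERALS: the large-field letter per uncovered cube, and N0v's rate bookkeeping WITH EQUALITY at the count rate `RI` -/

/-- THE LARGE-FIELD LETTER (toy numeral): `vO := e^{−5·RI}∕64` per uncovered cube of `Z∖Z′₀` (print's `e^{−(κ₁−1)}`, (2.35) KIND —
TYPE only), chosen so that `c₁·(vO·e^{RI·5}) = 1` at pv22's `c₁ = 64` and S40.1's link constant `c′ = 5`. [folklore] -/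
def vO : ℝ := Real.exp (-(RI N * 5)) / 64

/-- `0 < vO`. [arith] -/
theorem vO_pos : 0 < vO N := by unfold vO; positivity

/-- `vO ≤ 1∕64` (`e^{−5RI} ≤ 1`). [arith] -/
theorem vO_le : vO N ≤ 1 / 64 := by
  unfold vO
  have h : Real.exp (-(RI N * 5)) ≤ 1 := Real.exp_le_one_iff.2 (by linarith [RI_pos N])
  linarith

/-- **THE ENTROPY OF THE CUBES OUTSIDE Z′₀ COSTS EXACTLY ONE UNIT OF RATE**: `c₁·(vO·e^{RI·5}) = 1` at pv22's `c₁ = 64`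
(`torus_consts`). [arith] -/
theorem c₁v_eq_one : (tgeometry 4 N).c₁ * (vO N * Real.exp (RI N * 5)) = 1 := by
  rw [(torus_consts N).2.2]
  unfold vO
  have h : Real.exp (-(RI N * 5)) * Real.exp (RI N * 5) = 1 := by
    rw [← Real.exp_add, show -(RI N * 5) + RI N * 5 = 0 by ring, Real.exp_zero]
  linear_combination h

/-- **N0v's RATE BOOKKEEPING `hRR` WITH EQUALITY**: `RI − c₁·(vO·e^{RI·5}) = 2κ₀ + 2 = Rkp`. [arith] -/
theorem hRR_O_eq : RI N - (tgeometry 4 N).c₁ * (vO N * Real.exp (RI N * 5)) = 2 * (tgeometry 4 N).κ₀ + 2 := by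
  rw [c₁v_eq_one]; unfold RI; ring

/-- … hence N0v's binder `hRR : Rkp ≤ R − G.c₁·(v·e^{R·c′})` at `(Rkp, R, c′, v) = (2κ₀+2, RI, 5, vO)`. [arith] -/
theorem hRR_O : 2 * (tgeometry 4 N).κ₀ + 2 ≤ RI N - (tgeometry 4 N).c₁ * (vO N * Real.exp (RI N * 5)) :=
  (hRR_O_eq N).ge

/-! ## §2 THE INNER DATUM: two decided configurations per member, half the (2.36)-KIND member budget each -/

/-- THE MEMBER BUDGET (print's (2.36) right-hand side SHAPE at our numerals — TYPE only): `mO Z′ := α₆F·e^{−δFκF·d(Z′)}·e^{−RI(d(Z′)+5)}`,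
LITERALLY the bound `a·e^{−r d}·e^{−R(d+5)}` of N0v's `hmember` at `(a, r, R) = (α₆F, δF·κF, RI)`. [folklore] -/
def mO (Z' : TDom 4 N) : ℝ :=
  α₆F * Real.exp (-(δF * κF * (tsys 4 N).dj Z')) * Real.exp (-(RI N * ((tsys 4 N).dj Z' + 5)))

/-- `0 < mO Z′`. [arith] -/
theorem mO_pos (Z' : TDom 4 N) : 0 < mO N Z' := by unfold mO; have := α₆F_pos; positivity

/-- **AT THE UNIT CUBE THE MEMBER BUDGET IS `α₆F·e^{−5RI}`** (`d(X₀) = 0`, W41's `dj_X₀`). [arith] -/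
theorem mO_X₀ : mO N (X₀ N) = α₆F * Real.exp (-(RI N * 5)) := by
  unfold mO; rw [dj_X₀, mul_zero, neg_zero, Real.exp_zero, mul_one, zero_add]

/-- THE INNER WEIGHT (toy DATA): TWO decided configurations per member (`κ := fun _ => Bool`), each carrying HALF the member budget:
`nO Z′ b := ½·mO Z′` (print: «the components of Z₀ determining this Z′_i», (2.36) KIND — OUR toy choice, nothing of (B1b) claimed). [folklore] -/
def nO (Z' : TDom 4 N) (_b : Bool) : ℝ := 1 / 2 * mO N Z'

/-- `0 < nO Z′ b`. [arith] -/
theorem nO_pos (Z' : TDom 4 N) (b : Bool) : 0 < nO N Z' b := by unfold nO; have := mO_pos N Z'; positivity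

/-- N0v's `hn : ∀ Z j, 0 ≤ n Z j`. [arith] -/
theorem nO_nonneg : ∀ (Z' : (tsys 4 N).Dom) (b : Bool), 0 ≤ nO N Z' b := fun Z' b => (nO_pos N Z' b).le

/-- **N0v's MEMBER BUDGET `hmember` WITH EQUALITY**: the inner sum over the two configurations IS the budget —
`Σ_{b ∈ univ} nO Z′ b = ½·mO Z′ + ½·mO Z′ = mO Z′` (`Fintype.sum_bool`). [arith] -/
theorem hmember_O_eq (Z' : TDom 4 N) :
    ∑ b ∈ (fun _ : (tsys 4 N).Dom => (Finset.univ : Finset Bool)) Z', nO N Z' b =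
      α₆F * Real.exp (-(δF * κF * (tsys 4 N).dj Z')) * Real.exp (-(RI N * ((tsys 4 N).dj Z' + 5))) := by
  show ∑ b : Bool, nO N Z' b = mO N Z'
  rw [Fintype.sum_bool]; unfold nO; ring

/-- … hence N0v's binder `hmember` at `(J, n, a, r, R) = (fun _ => univ, nO, α₆F, δF·κF, RI)`. [arith] -/
theorem hmember_O : ∀ Z' : (tsys 4 N).Dom,
    ∑ b ∈ (fun _ : (tsys 4 N).Dom => (Finset.univ : Finset Bool)) Z', nO N Z' b ≤
      α₆F * Real.exp (-(δF * κF * (tsys 4 N).dj Z')) * Real.exp (-(RI N * ((tsys 4 N).dj Z' + 5))) :=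
  fun Z' => (hmember_O_eq N Z').le

/-! ## §3 LOCATED, IN KERNEL: the admissible outer labels of a unit cube are exactly THREE -/

/-- THE OUTER-LABEL TYPE of the torus (a type abbreviation, no data): `⟨W′, ⟨F, p⟩⟩` — the cubes outside `Z′₀`, a family of torus
domains (print's `Z′_i`), a dependent choice of one of the two configurations per member. [folklore] -/
abbrev OLabel : Type := Σ _ : Finset (TPt 4 N), Σ F : Finset (TDom 4 N), ∀ Z' ∈ F, Bool

open Classical in
/-- THE TERM INDEXING OF RECORD (toy DATA): the terms of a polymer `Z` are ALL admissible outer labels of its footprint — `W′ ⊆ Z`,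
`F` covering `Z ∖ W′` by torus domains, `p ∈ F.pi (fun _ => univ)` — N0v's `hadm` with EQUALITY (the admissible set of
`fibredCount_le` ∘ `familyPi_count_le` itself). [folklore] -/
def termsO (Z : TDom 4 N) : Finset (OLabel N) :=
  (Z.1).powerset.sigma fun W =>
    (coveringFamilies (Finset.univ : Finset (TDom 4 N)) (tgeometry 4 N).cubes (Z.1 \ W)).sigma fun F =>
      F.pi fun _ => (Finset.univ : Finset Bool)

open Classical in
/-- **N0v's ADMISSIBILITY `hadm` HOLDS ON THE INDEX OF RECORD** (membership unpacking; the pi-clause member-wise, as N0v states it).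
[folklore] -/
theorem hadm_O : ∀ Z : (tsys 4 N).Dom, ∀ l ∈ termsO N Z, l.1 ⊆ (tgeometry 4 N).cubes Z ∧
    l.2.1 ∈ coveringFamilies Finset.univ (tgeometry 4 N).cubes ((tgeometry 4 N).cubes Z \ l.1) ∧
      ∀ (Z' : (tsys 4 N).Dom) (h : Z' ∈ l.2.1), l.2.2 Z' h ∈ (fun _ : (tsys 4 N).Dom => (Finset.univ : Finset Bool)) Z' := by
  intro Z l hl
  unfold termsO at hl
  obtain ⟨hW, hq⟩ := Finset.mem_sigma.1 hl
  obtain ⟨hF, -⟩ := Finset.mem_sigma.1 hq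
  exact ⟨Finset.mem_powerset.1 hW, hF, fun Z' _ => Finset.mem_univ _⟩

open Classical in
/-- **… WITH EQUALITY**: the index of record IS N0v's admissible set — a label is a term of `Z` IFF it meets N0v's three `hadm` clauses
(`W′ ⊆ Z`, `F` covers `Z ∖ W′`, every chosen configuration admissible — the last vacuous at `J := univ`). [folklore] -/
theorem mem_termsO_iff (Z : TDom 4 N) (l : OLabel N) :
    l ∈ termsO N Z ↔ l.1 ⊆ (tgeometry 4 N).cubes Z ∧
      l.2.1 ∈ coveringFamilies Finset.univ (tgeometry 4 N).cubes ((tgeometry 4 N).cubes Z \ l.1) ∧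
        ∀ (Z' : TDom 4 N) (h : Z' ∈ l.2.1), l.2.2 Z' h ∈ (Finset.univ : Finset Bool) := by
  refine ⟨hadm_O N Z l, fun ⟨hW, hF, _⟩ => ?_⟩
  unfold termsO
  exact Finset.mem_sigma.2 ⟨Finset.mem_powerset.2 hW, Finset.mem_sigma.2 ⟨hF, Finset.mem_pi.2 fun Z' _ => Finset.mem_univ _⟩⟩

open Classical in
/-- **AT THE UNIT CUBE A SUM OVER THE OUTER LABELS IS THE TWO COVERED LABELS PLUS THE ONE UNCOVERED LABEL** [decided, kernel]:
fibre `W′ = ∅` — the one covering family `{X₀}` of W45's `coveringFamilies_unitCube` with either configuration `p X₀ ∈ {true, false}`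
(the sum over `({X₀}).pi (fun _ => univ)` is left as the dependent-choice sum it is); fibre `W′ = {0}` — the empty family covers `∅`
(W50's `coveringFamilies_emptyFootprint`) and carries the empty choice `Pi.empty` (`Finset.pi_empty`): the two-fibre split of N0v's
`fibredCount_le` (`Finset.sum_sigma`) read off. [folklore] -/
theorem sum_termsO_X₀ {M : Type*} [AddCommMonoid M] (f : OLabel N → M) :
    ∑ l ∈ termsO N (X₀ N), f l =
      (∑ p ∈ (({X₀ N} : Finset (TDom 4 N))).pi (fun _ => (Finset.univ : Finset Bool)), f ⟨∅, ⟨{X₀ N}, p⟩⟩) +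
        f ⟨{0}, ⟨∅, Finset.Pi.empty _⟩⟩ := by
  unfold termsO
  rw [Finset.sum_sigma, X₀_val, powerset_unitCube, Finset.sum_insert (by simp), Finset.sum_singleton]
  -- fibre `W′ = ∅`: the footprint `{0} ∖ ∅ = {0}` is covered by `{X₀}` only
  have hcov : coveringFamilies (Finset.univ : Finset (TDom 4 N)) (tgeometry 4 N).cubes (({0} : Finset (TPt 4 N)) \ ∅) = {{X₀ N}} := by
    rw [Finset.sdiff_empty]; exact coveringFamilies_unitCube N
  -- fibre `W′ = {0}`: the footprint `∅` is covered by the empty family only, whose only choice is `Pi.empty`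
  have hunc : coveringFamilies (Finset.univ : Finset (TDom 4 N)) (tgeometry 4 N).cubes (({0} : Finset (TPt 4 N)) \ {0}) = {∅} := by
    rw [Finset.sdiff_self]; exact coveringFamilies_emptyFootprint (tgeometry 4 N)
  rw [hcov, hunc, Finset.sum_sigma, Finset.sum_sigma, Finset.sum_singleton, Finset.sum_singleton, Finset.pi_empty,
    Finset.sum_singleton]

open Classical in
/-- **THE UNIT CUBE HAS EXACTLY THREE ADMISSIBLE OUTER LABELS** (`Finset.card_pi`: two choices on the one member `X₀`, one empty
choice). [folklore] -/
theorem card_termsO_X₀ : (termsO N (X₀ N)).card = 3 := by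
  rw [Finset.card_eq_sum_ones, sum_termsO_X₀, ← Finset.card_eq_sum_ones, Finset.card_pi, Finset.prod_singleton,
    Finset.card_univ, Fintype.card_bool]

/-! ## §4 THE LABEL-INDEXED CORES (toy DATA): one W33 core per outer label, weighted by N0v's majorant -/

/-- THE MAJORANT OF A LABEL (toy DATA): `majO ⟨W′, ⟨F, p⟩⟩ := vO^{#W′}·Π_{x ∈ F.attach} nO x (p x)` — LITERALLY the weight displayed
in N0v's `hAmp`∕`hCount` at `(v, n) = (vO, nO)` (print's (2.35)∕(2.36) SHAPE, TYPE only). [folklore] -/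
def majO (l : OLabel N) : ℝ := vO N ^ l.1.card * ∏ x ∈ l.2.1.attach, nO N x.1 (l.2.2 x.1 x.2)

/-- `0 < majO l`. [arith] -/
theorem majO_pos (l : OLabel N) : 0 < majO N l := by
  unfold majO
  exact mul_pos (pow_pos (vO_pos N) _) (Finset.prod_pos fun x _ => nO_pos N _ _)

/-- **THE UNCOVERED LABEL's MAJORANT IS THE LARGE-FIELD LETTER**: `majO ⟨{0}, ⟨∅, Pi.empty⟩⟩ = vO` (empty family, ONE uncovered
cube). [arith] -/
theorem majO_uncovered : majO N ⟨{0}, ⟨∅, Finset.Pi.empty _⟩⟩ = vO N := by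
  unfold majO
  rw [Finset.card_singleton, pow_one, Finset.attach_empty, Finset.prod_empty, mul_one]

open Classical in
/-- **THE COVERED FIBRE CARRIES THE MEMBER BUDGET IN FULL** [decided, kernel]: summed over the two configurations on the one member
`X₀`, `Σ_{p} majO ⟨∅, ⟨{X₀}, p⟩⟩ = Σ_b nO X₀ b = mO X₀ = α₆F·e^{−5RI}` — N0v §2's `Finset.prod_sum` read backwards on a one-member
family. [folklore] -/
theorem sum_majO_covered :
    ∑ p ∈ (({X₀ N} : Finset (TDom 4 N))).pi (fun _ => (Finset.univ : Finset Bool)), majO N ⟨∅, ⟨{X₀ N}, p⟩⟩ =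
      α₆F * Real.exp (-(RI N * 5)) := by
  unfold majO
  simp only [Finset.card_empty, pow_zero, one_mul]
  rw [← Finset.prod_sum, Finset.prod_singleton]
  show ∑ b : Bool, nO N (X₀ N) b = _
  rw [Fintype.sum_bool, ← mO_X₀]; unfold nO; ring

open Classical in
/-- **THE MAJORANT MASS AT THE UNIT CUBE IN CLOSED FORM**: `Σ_{l ∈ termsO X₀} majO l = α₆F·e^{−5RI} + vO` — the covered fibre's
member budget plus the uncovered fibre's large-field letter. [folklore] -/
theorem sum_majO_X₀ : ∑ l ∈ termsO N (X₀ N), majO N l = α₆F * Real.exp (-(RI N * 5)) + vO N := by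
  rw [sum_termsO_X₀, sum_majO_covered, majO_uncovered]

/-- … hence the majorant mass at `X₀` is `≤ 2` (`α₆F ≤ 1`, `e^{−5RI} ≤ 1`, `vO ≤ 1∕64`) — what PART 2's unit-disc bound uses. [arith] -/
theorem sum_majO_X₀_le_two : ∑ l ∈ termsO N (X₀ N), majO N l ≤ 2 := by
  rw [sum_majO_X₀]
  have h1 : α₆F * Real.exp (-(RI N * 5)) ≤ 1 :=
    mul_le_one₀ α₆F_le_one (Real.exp_pos _).le (Real.exp_le_one_iff.2 (by linarith [RI_pos N]))
  linarith [vO_le N]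

variable (r : ℝ) (hr : 0 ≤ r)

/-- THE LABEL-DEPENDENT CAUCHY WEIGHT (toy DATA): `cO l := (cM r∕2)·majO l` — W35's `cM` times N0v's MAJORANT of the label BY
CHOICE. [folklore] -/
def cO (l : OLabel N) : ℝ := cM r / 2 * majO N l

/-- `0 < cO l`. [arith] -/
theorem cO_pos (l : OLabel N) : 0 < cO N r l := mul_pos (half_pos (cM_pos r)) (majO_pos N l)

/-- **THE OUTER-LABEL-INDEXED CORE FAMILY** (toy DATA): at the label `l` W33's one-label core `coreW` (BY NAME) at the weight `cO l`
— one `BiCore toyFrame (fun _ : Unit => 0) ℂ Unit E1` per `(k, l, X)`. [folklore] -/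
def GO : ∀ (_ : ℕ) (_ : OLabel N), ℕ → BiCore toyFrame (fun _ : Unit => (0 : ℕ)) ℂ Unit E1 :=
  fun _ l _ => coreW (cO N r l) r hr

/-- The core at `(k, l, X)`. [folklore] -/
@[simp] theorem GO_apply (k : ℕ) (l : OLabel N) (X : ℕ) : GO N r hr k l X = coreW (cO N r l) r hr := rfl

open Classical in
/-- THE ACTIVITY OF RECORD (toy DATA): the sum of the label-indexed cores' terms over ALL admissible outer labels of the footprint,
along the pencil `s ↦ 0 + s • liveTable` — so N0v's `hact` holds by `rfl` and `hscale` by `rfl` (`emb Z := k`). [folklore] -/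
def actO (k : ℕ) (s : ℂ) (Z : TDom 4 N) : ℂ :=
  ∑ l ∈ termsO N Z, (GO N r hr k l k).termAt (0 : ℂ) ((0 : B13HistM toyFrame) + s • liveTable)

open Classical in
/-- **`hAmp` MET FOR EVERY SUB-POLYMER AND EVERY LABEL** [decided toy], in the LITERAL binder shape of N0v's END at NE5's toy letters
`(mq, bq, N₀) = (1, 0, 1)`, `ϱ = 2`, `R₀ = ‖0‖ + 2‖liveTable‖`, `A₀ = 0`, `A₁ = A∕4`: the core's letter mass times read-out growth is
`majO(l)·|cM r∕2|·√(2π)·e^{r·2‖liveTable‖} ≤ majO(l)·A∕2 = (0 + 2·(A∕4))·(vO^{#W′}·Π nO)` (W35's `letterMass_coreW`, W41's `budget_half`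
BY NAME). [folklore] -/
theorem hAmp_O (k : ℕ) :
    ∀ Z : (tsys 4 N).Dom, (tgeometry 4 N).cubes Z ⊆ (tgeometry 4 N).cubes (X₀ N) → ∀ l ∈ termsO N Z,
      (GO N r hr k l k).lam.real univ *
          ((GO N r hr k l k).wB * (fun (_ : ℕ) (_ : OLabel N) (_ : ℕ) => (1 : ℝ)) k l k *
            Real.exp ((fun (_ : ℕ) (_ : OLabel N) (_ : ℕ) => (0 : ℝ)) k l k)) *
          (Real.pi / ((fun (_ : ℕ) (_ : OLabel N) (_ : ℕ) => (1 : ℝ)) k l k / 2)) ^ (Module.finrank ℝ E1 / 2 : ℝ) *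
        Real.exp ((GO N r hr k l k).N₁ * (‖(0 : B13HistM toyFrame)‖ + 2 * ‖liveTable‖)) ≤
      (0 + 2 * (Acst / 4)) * (vO N ^ l.1.card * ∏ x ∈ l.2.1.attach, nO N x.1 (l.2.2 x.1 x.2)) := by
  intro Z _ l _
  simp only [GO_apply]
  rw [letterMass_coreW, N₁_coreW, norm_zero, zero_add]
  have hp : 0 ≤ majO N l := (majO_pos N l).le
  have hT : 2 * ‖liveTable‖ ≤ 2 := by linarith [norm_liveTable_le]
  have hb := budget_half r hr hT
  show |cM r / 2 * majO N l| * Real.sqrt (2 * Real.pi) * Real.exp (r * (2 * ‖liveTable‖)) ≤ (0 + 2 * (Acst / 4)) * majO N l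
  rw [abs_mul, abs_of_nonneg hp]
  calc |cM r / 2| * majO N l * Real.sqrt (2 * Real.pi) * Real.exp (r * (2 * ‖liveTable‖))
      = majO N l * (|cM r / 2| * Real.sqrt (2 * Real.pi) * Real.exp (r * (2 * ‖liveTable‖))) := by ring
    _ ≤ majO N l * (Acst / 2) := mul_le_mul_of_nonneg_left hb hp
    _ = (0 + 2 * (Acst / 4)) * majO N l := by ring

/-! ## §5 THE END FIRES: N0v's outer-labels END applied ONCE BY NAME (a decided applier), the link by S40.1's `link_torus'` -/

open Classical in
/-- **N0v's `attachedPart_locE_le_of_coresAt_pencil_outerLabels` FIRES** [decided toy]: ONE geometry, the torus `(tsys 4 N, tgeometry 4 N)`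
(the END lives at scale `k+1` — no `foot`, no `hmono`), cores `GO` indexed by outer labels, W33's `ctr0`∕`hroom0`, NE5's toy letters
INLINE, the pencil's two radius inequalities, `hscale`∕`hact` by `rfl`, W24's `hrate_torus` (`Rkp := 2κ₀+2`), W45's `hsmall_F`∕`hκ_F`∕
`h229_F` (`a := α₆F`, `r := δF·κF`), the inner datum `J := fun _ => univ`, `n := nO`, `hmember_O`, the count rate `R := RI`, `c′ := 5`
with the LINK SUPPLIED BY NAME from S40.1's `link_torus'`, `v := vO`, §1's `hRR_O`, `hadm_O`, `hAmp_O`, `hϱ : 2 ≤ 2`, `hϱA`.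
Conclusion LITERAL. [folklore] -/
theorem outerEnd_fires (k : ℕ) :
    ‖locE (tgeometry 4 N).ι (tgeometry 4 N).cubes (actO N r hr k 1) ((tgeometry 4 N).cubes (X₀ N)) -
        locE (tgeometry 4 N).ι (tgeometry 4 N).cubes (actO N r hr k 0) ((tgeometry 4 N).cubes (X₀ N))‖ ≤
      4 * (Real.exp 1 * (tgeometry 4 N).ν * (tgeometry 4 N).c₁ * (tgeometry 4 N).K₀ ^ 2) * (Acst / 4) *
        Real.exp (-(0 * (tsys 4 N).dj (X₀ N))) :=
  attachedPart_locE_le_of_coresAt_pencil_outerLabels (tsys 4 N) (tgeometry 4 N) (GO N r hr)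
    (Win := Set.univ) (ctr := ctr0) (ROp := fun _ => 1) (RHist := fun _ => 2) (R' := fun _ => 2)
    (mq := fun _ _ _ => 1) (bq := fun _ _ _ => 0) (N₀ := fun _ _ _ => 1)
    hroom0 (fun _ _ _ _ _ _ _ => one_pos)
    (fun _ _ _ _ _ _ _ => ⟨fun _ _ => aestronglyMeasurable_const, fun _ => differentiableOn_const _, fun _ _ _ => by
      show ‖(1 : ℂ)‖ ≤ 1; rw [norm_one]⟩)
    (fun _ _ _ _ _ _ _ => ⟨fun _ _ => (Complex.measurable_ofReal.comp (measurable_snd.norm.pow_const 2)).aestronglyMeasurable,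
      fun _ _ => differentiableOn_const _, fun _ _ _ v => by
        show 1 * ‖v‖ ^ 2 - 0 ≤ (((‖v‖ ^ 2 : ℝ) : ℂ)).re; rw [Complex.ofReal_re]; simp⟩)
    (g := fun _ => 0) (Set.mem_univ _) (U := ()) (o := 0) (h₀ := 0) (w := liveTable) (ϱ := 2)
    (by show ‖(0 : ℂ) - 0‖ ≤ 1; simp)
    (by show ‖(0 : B13HistM toyFrame) - 0‖ + 2 * ‖liveTable‖ ≤ 2; rw [sub_zero, norm_zero, zero_add];
        linarith [norm_liveTable_le])
    (emb := fun _ => k) (fun _ => rfl) (terms := termsO N) (act := actO N r hr k) (fun _ _ _ => rfl)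
    (A₀ := 0) (A₁ := Acst / 4) (Rkp := 2 * (tgeometry 4 N).κ₀ + 2) (r₁ := 0) (b₅ := 0) (X₀ := X₀ N)
    le_rfl (by have := Acst_pos; positivity) le_rfl (by norm_num) (hrate_torus N) (hsmall_F N)
    (fun _ => (Finset.univ : Finset Bool)) (nO N) (nO_nonneg N)
    (a := α₆F) (r := δF * κF) (R := RI N) (c' := 5) (v := vO N) α₆F_pos.le (vO_pos N).le (hκ_F N) (h229_F N)
    (hmember_O N) (fun Z W hW F hF => link_torus' 4 N Z W hW F hF) (hRR_O N) (hadm_O N) (hAmp_O N r hr k) le_rfl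
    (by have := Acst_pos; linarith)

open Classical in
/-- … in CLOSED FORM: `≤ 4·(e·9·64·K₀(64,8)²)·(A∕4) = K₀(64,8)` (pv22's constants by `torus_consts`∕`K₀_four` BY NAME). [folklore] -/
theorem outerEnd_fires_closed (k : ℕ) :
    ‖locE (tgeometry 4 N).ι (tgeometry 4 N).cubes (actO N r hr k 1) ((tgeometry 4 N).cubes (X₀ N)) -
        locE (tgeometry 4 N).ι (tgeometry 4 N).cubes (actO N r hr k 0) ((tgeometry 4 N).cubes (X₀ N))‖ ≤ K₀ 64 8 := by
  refine (outerEnd_fires N r hr k).trans (le_of_eq ?_)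
  rw [(torus_consts N).1, (torus_consts N).2.2, K₀_four, zero_mul, neg_zero, Real.exp_zero, mul_one]
  unfold Acst
  have hK := K₀_pos (64 : ℝ) 8
  have he := Real.exp_pos 1
  field_simp

end Torus

end Summit.QuantumFields.BalabanUV.T4Continuum.NE1p.DressedSmallFieldOuterLabelsWitness

end
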